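import Mathlib.RingTheory.MvPolynomial.WeightedHomogeneous
import Mathlib.RingTheory.Ideal.Operations
import HarnessLib

/-!
# Veronese splitting `hpow` for the relative weights `(2,3,9,3 | 0)`, `N = 18` — RGDD-L row F008 (and F010/F019/F192/F272, same facet)
# (crux `FInjectiveMacaulayfication`, relative engine `FilteredConeFiModelRel.filteredConeFiModelRel_affineBlowup`; RULING R15.44 (2)(b)
# of res-L1-w45a-plan-1: stub-4 = `hpow`, stub-1 = primality / `x̄ᵥ ≠ 0` / `hoff` / `hoff₀` + assembly `…RelGddF008.lean`)

Support file for crux stmt-ResolutionOfSingularities-15315 (`FrobeniusLadder.FInjectiveMacaulayfication`), chain w45a, seat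
res-L1-w45a-stub-4 g6. [OURS · L1 W4.5a; row F008 = res-L1-w45a-idea-2 RGDD-L census (f = T₁₁ + t·x³y·w³ + t²·z·w³ ⊂ 𝔸⁵, p = 5,
`L`-facet `w = (2,3,9,3 | t ↦ 0)`, `N = D = 18`), hpow at `N = lcm` decided by res-L1-w45a-tri-1 (TRIAGE v30 §45); template `GxzVeronese`
(p555926)] — NOT a statement of the manuscript; AI-written, weaker than expert review.

Variables `X₀ = x, X₁ = y, X₂ = z, X₃ = w, X₄ = t`, weights `w = ![2, 3, 9, 3, 0]` (the relative engine's convention: weight `0` off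
`J = {x,y,z,w}`), `N = 18 = lcm(2,3,9,3)`, `c = (9, 6, 2, 6)` on `J`.  **`hpow_2393_18`: every monomial of weighted degree `≥ 18·K`
lies in `I₁₈^K`**, in the exact binder shape of `filteredConeFiModelRel_affineBlowup` (pass it by name).

Proof (`coord_split`): the weight-`0` exponent of `t` rides along in the cofactor; on the four weighted coordinates peel a PURE block
`x⁹`, `y⁶`, `z²`, `w⁶` when one divides; inside the remaining box an 8-LEAF threshold tree (machine-found by the generator
`L/res-L1-w45a-stub-4/gxz-veronese/vtree/emit_generic.py` over the 23 exact-18 blocks; each leaf an exact block dividing the monomial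
or a region of weight `< 36`, hence `K = 0`), `omega` at every leaf. [folklore]
-/

-- single-problem summit: the doubled namespace component is forced
set_option linter.dupNamespace false

namespace Summit.ResolutionOfSingularities.ResolutionOfSingularities.Theorems.FInjectiveMacaulayfication.RelGddF008Hpow

/-- **Coordinate splitting** for `w = (2,3,9,3 | 0)`, `N = 18`: if `(K+1)·18 ≤ 2a₀ + 3a₁ + 9a₂ + 3a₃` then `a = b + c` with `18 ≤ w·b`,
`K·18 ≤ w·c`, and the weight-`0` coordinate `a₄` entirely in `c` (pure blocks, then a machine-found 8-leaf threshold tree with `omega`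
leaves). [folklore] -/
theorem coord_split (K a₀ a₁ a₂ a₃ : ℕ)
    (h : (K + 1) * 18 ≤ 2 * a₀ + 3 * a₁ + 9 * a₂ + 3 * a₃) :
    ∃ b₀ b₁ b₂ b₃ c₀ c₁ c₂ c₃ : ℕ, a₀ = b₀ + c₀ ∧ a₁ = b₁ + c₁ ∧ a₂ = b₂ + c₂ ∧ a₃ = b₃ + c₃ ∧
      18 ≤ 2 * b₀ + 3 * b₁ + 9 * b₂ + 3 * b₃ ∧ K * 18 ≤ 2 * c₀ + 3 * c₁ + 9 * c₂ + 3 * c₃ := by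
  -- pure blocks of weight exactly `18`
  by_cases p₀ : 9 ≤ a₀
  · exact ⟨9, 0, 0, 0, a₀ - 9, a₁, a₂, a₃, by omega⟩
  by_cases p₁ : 6 ≤ a₁
  · exact ⟨0, 6, 0, 0, a₀, a₁ - 6, a₂, a₃, by omega⟩
  by_cases p₂ : 2 ≤ a₂
  · exact ⟨0, 0, 2, 0, a₀, a₁, a₂ - 2, a₃, by omega⟩
  by_cases p₃ : 6 ≤ a₃
  · exact ⟨0, 0, 0, 6, a₀, a₁, a₂, a₃ - 6, by omega⟩
  -- the exponent box `a₀ < 9, a₁ < 6, a₂ < 2, a₃ < 6`: machine-found threshold tree, `omega` at the leaves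
  exact
    if _h : 1 ≤ a₂ then
     if _h : 3 ≤ a₃ then ⟨0, 0, 1, 3, a₀, a₁, a₂ - 1, a₃ - 3, by omega⟩ else
     if _h : a₁ < 1 then ⟨a₀, a₁, a₂, a₃, 0, 0, 0, 0, by omega⟩ else
     if _h : 3 ≤ a₀ then ⟨3, 1, 1, 0, a₀ - 3, a₁ - 1, a₂ - 1, a₃, by omega⟩
     else ⟨a₀, a₁, a₂, a₃, 0, 0, 0, 0, by omega⟩
    else
     if _h : a₁ < 2 then ⟨a₀, a₁, a₂, a₃, 0, 0, 0, 0, by omega⟩ else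
     if _h : 4 ≤ a₃ then ⟨0, 2, 0, 4, a₀, a₁ - 2, a₂, a₃ - 4, by omega⟩ else
     if _h : 6 ≤ a₀ then ⟨6, 2, 0, 0, a₀ - 6, a₁ - 2, a₂, a₃, by omega⟩
     else ⟨a₀, a₁, a₂, a₃, 0, 0, 0, 0, by omega⟩


/-- The `(2,3,9,3 | 0)`-weighted degree in coordinates (the weight-`0` variable `X₄ = t` does not count). [folklore] -/
theorem weight_eq (f : Fin 5 →₀ ℕ) :
    Finsupp.weight (![2, 3, 9, 3, 0] : Fin 5 → ℕ) f = 2 * f 0 + 3 * f 1 + 9 * f 2 + 3 * f 3 := by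
  rw [Finsupp.weight_apply,
    Finsupp.sum_fintype f (fun i c => c • (![2, 3, 9, 3, 0] : Fin 5 → ℕ) i) (fun _ => zero_smul ℕ _),
    Fin.sum_univ_five]
  simp only [smul_eq_mul, Matrix.cons_val_zero, Matrix.cons_val_one, Matrix.cons_val]
  ring

/-- **Exponent-vector splitting** (`coord_split` along `Finsupp.equivFunOnFinite`; the `t`-exponent goes to the cofactor). [folklore] -/
theorem finsupp_split (K : ℕ) (a : Fin 5 →₀ ℕ)
    (ha : (K + 1) * 18 ≤ Finsupp.weight (![2, 3, 9, 3, 0] : Fin 5 → ℕ) a) :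
    ∃ b c : Fin 5 →₀ ℕ, a = b + c ∧ 18 ≤ Finsupp.weight (![2, 3, 9, 3, 0] : Fin 5 → ℕ) b ∧
      K * 18 ≤ Finsupp.weight (![2, 3, 9, 3, 0] : Fin 5 → ℕ) c := by
  rw [weight_eq] at ha
  obtain ⟨b₀, b₁, b₂, b₃, c₀, c₁, c₂, c₃, e₀, e₁, e₂, e₃, hb, hc⟩ := coord_split K (a 0) (a 1) (a 2) (a 3) ha
  refine ⟨Finsupp.equivFunOnFinite.symm ![b₀, b₁, b₂, b₃, 0], Finsupp.equivFunOnFinite.symm ![c₀, c₁, c₂, c₃, a 4],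
    ?_, ?_, ?_⟩
  · ext i
    fin_cases i <;> simp [e₀, e₁, e₂, e₃]
  · rw [weight_eq]
    simpa using hb
  · rw [weight_eq]
    simpa using hc

/-- **VERONESE SPLITTING `hpow` for `w = (2,3,9,3 | 0)`, `N = 18`** — the `hpow` binder of
`FilteredConeFiModelRel.filteredConeFiModelRel_affineBlowup` for RGDD-L row F008 (and every row with the same facet), VERBATIM in the
engine's shape: every monomial of weighted degree `≥ 18·K` lies in `I₁₈^K`. [folklore] -/
theorem hpow_2393_18 : ∀ (k : Type) [Field k] (K : ℕ) (b : Fin 5 →₀ ℕ),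
    K * 18 ≤ Finsupp.weight (![2, 3, 9, 3, 0] : Fin 5 → ℕ) b →
    (MvPolynomial.monomial b (1 : k) : MvPolynomial (Fin 5) k) ∈
      (Ideal.span {m : MvPolynomial (Fin 5) k | ∃ b : Fin 5 →₀ ℕ,
        18 ≤ Finsupp.weight (![2, 3, 9, 3, 0] : Fin 5 → ℕ) b ∧ m = MvPolynomial.monomial b 1}) ^ K := by
  intro k _ K
  induction K with
  | zero =>
    intro a _
    rw [pow_zero, Ideal.one_eq_top]
    exact Submodule.mem_top
  | succ K ih =>
    intro a ha
    obtain ⟨b, c, rfl, hb, hc⟩ := finsupp_split K a ha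
    have hmul : (MvPolynomial.monomial (b + c) (1 : k) : MvPolynomial (Fin 5) k) =
        MvPolynomial.monomial b 1 * MvPolynomial.monomial c 1 := by
      rw [MvPolynomial.monomial_mul, one_mul]
    rw [pow_succ', hmul]
    exact Ideal.mul_mem_mul (Ideal.subset_span ⟨b, hb, rfl⟩) (ih c hc)

end Summit.ResolutionOfSingularities.ResolutionOfSingularities.Theorems.FInjectiveMacaulayfication.RelGddF008Hpow
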